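import Summits.QuantumFields.QCD.Theses.OverlapPositivityTransfer

/-!
# Birth skeleton — piece A `OverlapConvergentClosure` of the decomposition of `OverlapContinuumLimit`

Line: ENGINE + CLOSURE.  `stub_engine` (hard, the UV/IR analysis on the POSITIVE admissible-overlap measure):
from the chiral gap package of `reg`, along a reindexed regularisation `reg'` and calibrated species
renormalisations `z, shift`, the renormalised overlap lattice Schwinger functions obey k-UNIFORM linear-growth
bounds on off-diagonal real tensors, CONVERGE along the full sequence, CLUSTER exponentially at the lattice rate
`Δ(m)` uniformly in `k` (time and space), and carry eventual non-triviality / κ₃ lower bounds.  `stub_closure`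
(soft functional analysis: Banach–Steinhaus, density of off-diagonal real tensors in `⁰𝒮`, Whitney flatness,
lattice translation/reflection/permutation symmetries of the honest functional): such a lattice family has a
limit `S` (continuous on `𝓢`) that is normalised, hermitian, of linear growth, translation invariant, symmetric,
clustering, inherits the witnesses and has the species mass gap `S.HasMassGap Δ`.  `OverlapConvergentClosure_of`
composes them (pure logic).
-/

namespace Summit.QuantumFields.QCD.Cruxes.OverlapConvergentClosure.Birth

open scoped BigOperators Topology ComplexConjugate
open Filter
open Literature.MathematicalPhysics.QuantumFieldTheory Literature.MathematicalPhysics.QuantumLattice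
  Literature.MathematicalPhysics.AQFT
open Summit.QuantumFields.QCD.Theses.OverlapPositivityTransfer

/-- ENGINE (hard): the lattice-level uniform package along a reindexed regularisation. -/
theorem stub_engine : ∀ Nf : ℕ, Nf = 2 ∨ Nf = 3 → ∀ reg : QCDRegularisation Nf, reg.HasMassScaling → reg.OverlapGapClosesAtZero → reg.HasOverlapGapAtPositiveMass → ∃ reg' : QCDRegularisation Nf, reg'.HasMassScaling ∧ reg'.OverlapGapClosesAtZero ∧ ∀ m : Fin Nf → ℝ, (∀ f, 0 < m f) → ∃ (z shift : QCDField Nf → ℕ → ℝ) (Δ : ℝ), 0 < Δ ∧ (reg'.scheme m z shift).HasAsymptoticScaling ∧ (∀ fl : Fin Nf, ∀ᶠ k in Filter.atTop, 0 < (reg'.scheme m z shift).mq fl k ∧ (reg'.scheme m z shift).mq fl k < 2) ∧ (reg'.scheme m z shift).OverlapHasLatticeMassGap Δ ∧ (∃ (s : ℕ) (α β : ℝ), ∀ᶠ k in Filter.atTop, ∀ n : ℕ, n ≠ 0 → ∀ (σ : Fin n → QCDField Nf) (f : Fin n → SchwartzMap (EuclideanSpace ℝ (Fin 4)) ℝ)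 (F : SchwartzMap (Fin n → EuclideanSpace ℝ (Fin 4)) ℂ), IsTensorOf F (fun i => ofRealTest (f i)) → IsOffDiagonal F → ‖overlapLatticeSchwinger (reg'.scheme m z shift) k n σ f‖ ≤ α * (n.factorial : ℝ) ^ β * schwartzNorm (n * s) F) ∧ (∀ n : ℕ, n ≠ 0 → ∀ (σ : Fin n → QCDField Nf) (f : Fin n → SchwartzMap (EuclideanSpace ℝ (Fin 4)) ℝ) (F : SchwartzMap (Fin n → EuclideanSpace ℝ (Fin 4)) ℂ), IsTensorOf F (fun i => ofRealTest (f i)) → IsOffDiagonal F → ∃ c : ℂ, Filter.Tendsto (fun k : ℕ => overlapLatticeSchwinger (reg'.scheme m z shift) k n σ f) Filter.atTop (nhds c)) ∧ (∀ (n₁ n₂ : ℕ) (σ : Fin n₁ → QCDField Nf) (σ' : Fin n₂ → QCDField Nf) (f : Fin n₁ → SchwartzMap (EuclideanSpace ℝ (Fin 4)) ℝ) (g : Fin n₂ → SchwartzMap (EuclideanSpace ℝ (Fin 4)) ℝ), (∀ i, tsupport ((f i : SchwartzMap (EuclideanSpace ℝ (Fin 4)) ℝ) : EuclideanSpace ℝ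 (Fin 4) → ℝ) ⊆ {x | 0 < x 0}) → (∀ j, tsupport ((g j : SchwartzMap (EuclideanSpace ℝ (Fin 4)) ℝ) : EuclideanSpace ℝ (Fin 4) → ℝ) ⊆ {x | 0 < x 0}) → ∃ C : ℝ, ∀ᶠ k in Filter.atTop, ∀ t : ℝ, 0 ≤ t → ‖overlapLatticeSchwinger (reg'.scheme m z shift) k (n₁ + n₂) (Fin.append (σ ∘ Fin.rev) σ') (Fin.append (fun i => thetaTest 4 (f (Fin.rev i))) (fun j => translateTest (t • EuclideanSpace.single (0 : Fin 4) (1 : ℝ)) (g j))) - overlapLatticeSchwinger (reg'.scheme m z shift) k n₁ (σ ∘ Fin.rev) (fun i => thetaTest 4 (f (Fin.rev i))) * overlapLatticeSchwinger (reg'.scheme m z shift) k n₂ σ' g‖ ≤ C * Real.exp (-(Δ * t))) ∧ (∀ (n₁ n₂ : ℕ) (σ : Fin n₁ → QCDField Nf) (σ' : Fin n₂ → QCDField Nf) (f : Fin n₁ → SchwartzMap (EuclideanSpace ℝ (Fin 4)) ℝ) (g : Fin n₂ → SchwartzMap (EuclideanSpace ℝ (Fin 4)) ℝ) (a : EuclideanSpace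 ℝ (Fin 4)), a 0 = 0 → a ≠ 0 → (∀ i, tsupport ((f i : SchwartzMap (EuclideanSpace ℝ (Fin 4)) ℝ) : EuclideanSpace ℝ (Fin 4) → ℝ) ⊆ {x | 0 < x 0}) → (∀ j, tsupport ((g j : SchwartzMap (EuclideanSpace ℝ (Fin 4)) ℝ) : EuclideanSpace ℝ (Fin 4) → ℝ) ⊆ {x | 0 < x 0}) → ∃ C : ℝ, ∀ᶠ k in Filter.atTop, ∀ t : ℝ, 0 ≤ t → ‖overlapLatticeSchwinger (reg'.scheme m z shift) k (n₁ + n₂) (Fin.append (σ ∘ Fin.rev) σ') (Fin.append (fun i => thetaTest 4 (f (Fin.rev i))) (fun j => translateTest (t • a) (g j))) - overlapLatticeSchwinger (reg'.scheme m z shift) k n₁ (σ ∘ Fin.rev) (fun i => thetaTest 4 (f (Fin.rev i))) * overlapLatticeSchwinger (reg'.scheme m z shift) k n₂ σ' g‖ ≤ C * Real.exp (-(Δ * (t * ‖a‖)))) ∧ (∀ s : QCDField Nf, (s = QCDField.glue ∨ ∃ f g : Fin Nf, f ≠ g ∧ s = QCDField.pseudoRe f g) → ∃ (f₀ g₀ :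 SchwartzMap (EuclideanSpace ℝ (Fin 4)) ℝ), tsupport ((f₀ : SchwartzMap (EuclideanSpace ℝ (Fin 4)) ℝ) : EuclideanSpace ℝ (Fin 4) → ℝ) ⊆ {x | 0 < x 0} ∧ tsupport ((g₀ : SchwartzMap (EuclideanSpace ℝ (Fin 4)) ℝ) : EuclideanSpace ℝ (Fin 4) → ℝ) ⊆ {x | 0 < x 0} ∧ ∃ ε > (0 : ℝ), ∀ᶠ k in Filter.atTop, ε ≤ ‖overlapLatticeSchwinger (reg'.scheme m z shift) k 2 ![s, s] ![thetaTest 4 f₀, g₀] - overlapLatticeSchwinger (reg'.scheme m z shift) k 1 ![s] ![thetaTest 4 f₀] * overlapLatticeSchwinger (reg'.scheme m z shift) k 1 ![s] ![g₀]‖) ∧ (∃ f g h : SchwartzMap (EuclideanSpace ℝ (Fin 4)) ℝ, tsupport ((f : SchwartzMap (EuclideanSpace ℝ (Fin 4)) ℝ) : EuclideanSpace ℝ (Fin 4) → ℝ) ⊆ {x | x 0 < 0} ∧ tsupport ((g : SchwartzMap (EuclideanSpace ℝ (Fin 4)) ℝ) : EuclideanSpace ℝ (Fin 4) → ℝ)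 ⊆ {x | 0 < x 0 ∧ x 0 < 1} ∧ tsupport ((h : SchwartzMap (EuclideanSpace ℝ (Fin 4)) ℝ) : EuclideanSpace ℝ (Fin 4) → ℝ) ⊆ {x | 1 < x 0} ∧ ∃ ε > (0 : ℝ), ∀ᶠ k in Filter.atTop, ε ≤ ‖overlapLatticeSchwinger (reg'.scheme m z shift) k 3 ![QCDField.glue, QCDField.glue, QCDField.glue] ![f, g, h] - overlapLatticeSchwinger (reg'.scheme m z shift) k 1 ![QCDField.glue] ![f] * overlapLatticeSchwinger (reg'.scheme m z shift) k 2 ![QCDField.glue, QCDField.glue] ![g, h] - overlapLatticeSchwinger (reg'.scheme m z shift) k 1 ![QCDField.glue] ![g] * overlapLatticeSchwinger (reg'.scheme m z shift) k 2 ![QCDField.glue, QCDField.glue] ![f, h] - overlapLatticeSchwinger (reg'.scheme m z shift) k 1 ![QCDField.glue] ![h] * overlapLatticeSchwinger (reg'.scheme m z shift) k 2 ![QCDField.glue, QCDField.glue] ![f, g] + 2 * (overlapLatticeSchwinger (reg'.scheme m z shift) k 1 ![QCDField.glue] ![f] * overlapLatticeSchwinger (reg'.scheme m z shift) k 1 ![QCDField.glue]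 ![g] * overlapLatticeSchwinger (reg'.scheme m z shift) k 1 ![QCDField.glue] ![h])‖) := by
  sorry

/-- CLOSURE (soft): a lattice family with the uniform package has an OS-closed-modulo-E1/E2 limit. -/
theorem stub_closure : ∀ (Nf : ℕ) (sch : QCDScheme Nf) (Δ : ℝ), 0 < Δ → (∃ (s : ℕ) (α β : ℝ), ∀ᶠ k in Filter.atTop, ∀ n : ℕ, n ≠ 0 → ∀ (σ : Fin n → QCDField Nf) (f : Fin n → SchwartzMap (EuclideanSpace ℝ (Fin 4)) ℝ) (F : SchwartzMap (Fin n → EuclideanSpace ℝ (Fin 4)) ℂ), IsTensorOf F (fun i => ofRealTest (f i)) → IsOffDiagonal F → ‖overlapLatticeSchwinger sch k n σ f‖ ≤ α * (n.factorial : ℝ) ^ β * schwartzNorm (n * s) F) → (∀ n : ℕ, n ≠ 0 → ∀ (σ : Fin n → QCDField Nf) (f : Fin n → SchwartzMap (EuclideanSpace ℝ (Fin 4)) ℝ) (F : SchwartzMap (Fin n → EuclideanSpace ℝ (Fin 4)) ℂ), IsTensorOf F (fun i => ofRealTest (f i)) → IsOffDiagonal F → ∃ c : ℂ, Filter.Tendsto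 (fun k : ℕ => overlapLatticeSchwinger sch k n σ f) Filter.atTop (nhds c)) → (∀ (n₁ n₂ : ℕ) (σ : Fin n₁ → QCDField Nf) (σ' : Fin n₂ → QCDField Nf) (f : Fin n₁ → SchwartzMap (EuclideanSpace ℝ (Fin 4)) ℝ) (g : Fin n₂ → SchwartzMap (EuclideanSpace ℝ (Fin 4)) ℝ), (∀ i, tsupport ((f i : SchwartzMap (EuclideanSpace ℝ (Fin 4)) ℝ) : EuclideanSpace ℝ (Fin 4) → ℝ) ⊆ {x | 0 < x 0}) → (∀ j, tsupport ((g j : SchwartzMap (EuclideanSpace ℝ (Fin 4)) ℝ) : EuclideanSpace ℝ (Fin 4) → ℝ) ⊆ {x | 0 < x 0}) → ∃ C : ℝ, ∀ᶠ k in Filter.atTop, ∀ t : ℝ, 0 ≤ t → ‖overlapLatticeSchwinger sch k (n₁ + n₂) (Fin.append (σ ∘ Fin.rev) σ') (Fin.append (fun i => thetaTest 4 (f (Fin.rev i))) (fun j => translateTest (t • EuclideanSpace.single (0 : Fin 4) (1 : ℝ)) (g j))) - overlapLatticeSchwinger sch k n₁ (σ ∘ Fin.rev) (fun i => thetaTest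 4 (f (Fin.rev i))) * overlapLatticeSchwinger sch k n₂ σ' g‖ ≤ C * Real.exp (-(Δ * t))) → (∀ (n₁ n₂ : ℕ) (σ : Fin n₁ → QCDField Nf) (σ' : Fin n₂ → QCDField Nf) (f : Fin n₁ → SchwartzMap (EuclideanSpace ℝ (Fin 4)) ℝ) (g : Fin n₂ → SchwartzMap (EuclideanSpace ℝ (Fin 4)) ℝ) (a : EuclideanSpace ℝ (Fin 4)), a 0 = 0 → a ≠ 0 → (∀ i, tsupport ((f i : SchwartzMap (EuclideanSpace ℝ (Fin 4)) ℝ) : EuclideanSpace ℝ (Fin 4) → ℝ) ⊆ {x | 0 < x 0}) → (∀ j, tsupport ((g j : SchwartzMap (EuclideanSpace ℝ (Fin 4)) ℝ) : EuclideanSpace ℝ (Fin 4) → ℝ) ⊆ {x | 0 < x 0}) → ∃ C : ℝ, ∀ᶠ k in Filter.atTop, ∀ t : ℝ, 0 ≤ t → ‖overlapLatticeSchwinger sch k (n₁ + n₂) (Fin.append (σ ∘ Fin.rev) σ') (Fin.append (fun i => thetaTest 4 (f (Fin.rev i))) (fun j => translateTest (t • a) (g j))) - overlapLatticeSchwinger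 sch k n₁ (σ ∘ Fin.rev) (fun i => thetaTest 4 (f (Fin.rev i))) * overlapLatticeSchwinger sch k n₂ σ' g‖ ≤ C * Real.exp (-(Δ * (t * ‖a‖)))) → (∀ s : QCDField Nf, (s = QCDField.glue ∨ ∃ f g : Fin Nf, f ≠ g ∧ s = QCDField.pseudoRe f g) → ∃ (f₀ g₀ : SchwartzMap (EuclideanSpace ℝ (Fin 4)) ℝ), tsupport ((f₀ : SchwartzMap (EuclideanSpace ℝ (Fin 4)) ℝ) : EuclideanSpace ℝ (Fin 4) → ℝ) ⊆ {x | 0 < x 0} ∧ tsupport ((g₀ : SchwartzMap (EuclideanSpace ℝ (Fin 4)) ℝ) : EuclideanSpace ℝ (Fin 4) → ℝ) ⊆ {x | 0 < x 0} ∧ ∃ ε > (0 : ℝ), ∀ᶠ k in Filter.atTop, ε ≤ ‖overlapLatticeSchwinger sch k 2 ![s, s] ![thetaTest 4 f₀, g₀] - overlapLatticeSchwinger sch k 1 ![s] ![thetaTest 4 f₀] * overlapLatticeSchwinger sch k 1 ![s] ![g₀]‖) → (∃ f g h : SchwartzMap (EuclideanSpace ℝ (Fin 4)) ℝ, tsupport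 ((f : SchwartzMap (EuclideanSpace ℝ (Fin 4)) ℝ) : EuclideanSpace ℝ (Fin 4) → ℝ) ⊆ {x | x 0 < 0} ∧ tsupport ((g : SchwartzMap (EuclideanSpace ℝ (Fin 4)) ℝ) : EuclideanSpace ℝ (Fin 4) → ℝ) ⊆ {x | 0 < x 0 ∧ x 0 < 1} ∧ tsupport ((h : SchwartzMap (EuclideanSpace ℝ (Fin 4)) ℝ) : EuclideanSpace ℝ (Fin 4) → ℝ) ⊆ {x | 1 < x 0} ∧ ∃ ε > (0 : ℝ), ∀ᶠ k in Filter.atTop, ε ≤ ‖overlapLatticeSchwinger sch k 3 ![QCDField.glue, QCDField.glue, QCDField.glue] ![f, g, h] - overlapLatticeSchwinger sch k 1 ![QCDField.glue] ![f] * overlapLatticeSchwinger sch k 2 ![QCDField.glue, QCDField.glue] ![g, h] - overlapLatticeSchwinger sch k 1 ![QCDField.glue] ![g] * overlapLatticeSchwinger sch k 2 ![QCDField.glue, QCDField.glue] ![f, h] - overlapLatticeSchwinger sch k 1 ![QCDField.glue] ![h] * overlapLatticeSchwinger sch k 2 ![QCDField.glue, QCDField.glue] ![f, g] + 2 * (overlapLatticeSchwinger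 sch k 1 ![QCDField.glue] ![f] * overlapLatticeSchwinger sch k 1 ![QCDField.glue] ![g] * overlapLatticeSchwinger sch k 1 ![QCDField.glue] ![h])‖) → ∃ S : LabelledSchwingerFamily (QCDField Nf) (EuclideanSpace ℝ (Fin 4)), (∀ n : ℕ, n ≠ 0 → ∀ (σ : Fin n → QCDField Nf) (f : Fin n → SchwartzMap (EuclideanSpace ℝ (Fin 4)) ℝ) (F : SchwartzMap (Fin n → EuclideanSpace ℝ (Fin 4)) ℂ), IsTensorOf F (fun i => ofRealTest (f i)) → IsOffDiagonal F → Filter.Tendsto (fun k : ℕ => overlapLatticeSchwinger sch k n σ f) Filter.atTop (nhds (S n σ F))) ∧ S.IsNormalized ∧ S.IsHermitian ∧ S.HasLinearGrowth ∧ (∀ (n : ℕ) (σ : Fin n → QCDField Nf) (a : EuclideanSpace ℝ (Fin 4)) (F : SchwartzMap (Fin n → EuclideanSpace ℝ (Fin 4)) ℂ), IsOffDiagonal F → S n σ (translateMulti a F) = S n σ F) ∧ S.IsSymmetric ∧ S.HasClusterProperty ∧ (∀ s : QCDField Nf, (s = QCDField.glue ∨ ∃ f g : Fin Nf, f ≠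 g ∧ s = QCDField.pseudoRe f g) → ∃ (F G : SchwartzMap (Fin 1 → EuclideanSpace ℝ (Fin 4)) ℂ) (H : SchwartzMap (Fin (1 + 1) → EuclideanSpace ℝ (Fin 4)) ℂ), IsTimeOrdered F ∧ IsTimeOrdered G ∧ IsAppendTensorOf H (osAdjoint F) G ∧ S (1 + 1) (fun _ => s) H ≠ S 1 (fun _ => s) (osAdjoint F) * S 1 (fun _ => s) G) ∧ (∃ (f g h : SchwartzMap (EuclideanSpace ℝ (Fin 4)) ℂ) (Ffgh : SchwartzMap (Fin 3 → EuclideanSpace ℝ (Fin 4)) ℂ) (Fgh Ffh Ffg : SchwartzMap (Fin 2 → EuclideanSpace ℝ (Fin 4)) ℂ) (Ff Fg Fh : SchwartzMap (Fin 1 → EuclideanSpace ℝ (Fin 4)) ℂ), IsTensorOf Ffgh ![f, g, h] ∧ IsOffDiagonal Ffgh ∧ IsTensorOf Fgh ![g, h] ∧ IsTensorOf Ffh ![f, h] ∧ IsTensorOf Ffg ![f, g] ∧ IsTensorOf Ff ![f] ∧ IsTensorOf Fg ![g] ∧ IsTensorOf Fh ![h] ∧ S 3 (fun _ => QCDField.glue)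 Ffgh - S 1 (fun _ => QCDField.glue) Ff * S 2 (fun _ => QCDField.glue) Fgh - S 1 (fun _ => QCDField.glue) Fg * S 2 (fun _ => QCDField.glue) Ffh - S 1 (fun _ => QCDField.glue) Fh * S 2 (fun _ => QCDField.glue) Ffg + 2 * (S 1 (fun _ => QCDField.glue) Ff * S 1 (fun _ => QCDField.glue) Fg * S 1 (fun _ => QCDField.glue) Fh) ≠ 0) ∧ S.HasMassGap Δ := by
  sorry

/-- Composition (pure logic): engine + closure give piece A. -/
theorem OverlapConvergentClosure_of :
    Summit.QuantumFields.QCD.Theses.OverlapPositivityTransfer.OverlapConvergentClosure := by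
  intro Nf hNf hpkg
  obtain ⟨reg, hMS, hχ, hpos⟩ := hpkg
  obtain ⟨reg', hMS', hχ', H⟩ := stub_engine Nf hNf reg hMS hχ hpos
  refine ⟨reg', hMS', hχ', fun m hm => ?_⟩
  obtain ⟨z, shift, Δ, hΔ, hAF, hwin, hgap, hU1, hU2, hU4T, hU4S, hW2, hW3⟩ := H m hm
  obtain ⟨S, hconv, hnorm, hherm, hgrowth, htransl, hsymm, hclus, hNT, hNG, hgapS⟩ :=
    stub_closure Nf (reg'.scheme m z shift) Δ hΔ hU1 hU2 hU4T hU4S hW2 hW3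
  exact ⟨z, shift, S, hAF, hwin, hconv, hnorm, hherm, hgrowth, htransl, hsymm, hclus, hNT, hNG, Δ, hΔ, hgapS, hgap⟩

end Summit.QuantumFields.QCD.Cruxes.OverlapConvergentClosure.Birth
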